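import Literature.MathematicalPhysics.QuantumFieldTheory.Balaban1983to89.Node00.ROperationOfRecord

/-!
# NODE 00 — DEFINER ₇, FILE 7 (desk bytes until the signature is countersigned): the R-STEP ON (2.18) REPRESENTATIONS —
# (0.3) [IV] re-indexed by admissible sequences, as ONE generic map `Step.Repr218 → Step.Repr218` given the selector data

Seat `pub-ymgap-node00-def-R` (DEFINER ₇).  [IV] = [Balaban1989LargeFieldI], [III] = [Balaban1988Convergent].

WHY.  node00-def's Stage-₉ design of record (chair ★★ R437 (1); `Record9Skeleton` 63b1f6914ea0fc68) carries the densities as REPRESENTED towers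
and asks for `Rstep : (k : ℕ) → Step.Repr218 (F.P p.K) (SU N) (k+1) → Step.Repr218 … (k+1)`, ONE signature agreed between def-R and def-T.
This file is def-R's proposal [NODE00-DEF-R-G0-RSTEP-SIG-1] in kernel form.  (0.3) p. 176 reads *"(𝐑ρ)(V) = Σ_Z ρ(Z″, V) ∫dV⌈_{Z′} ρ(Z, V)
[∫dV⌈_{Z′} ρ(Z″, V)]⁻¹"*.  Index the terms by the admissible SEQUENCES `a` of (2.18) (the class decision (ii) p. 177 reads the history of
the sequence, so `Z′` is a function of `a`, not of the last region alone): with `t_a := χ_k(a)·(𝐓_k e^{A_k})(a)`, a selector `sel : a ↦ a″`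
(print's «term ρ(Z″, ·)») and the `Z′`-variables `fib a`, (0.3) is b01's `RopReal t sel fib = Σ_a t_{a″}·∫⌈_{fib a} t_a ∕ ∫⌈_{fib a} t_{a″}`, and
re-indexing the sum by `a' = a″` exhibits it AGAIN in the form (2.18) with the SAME index set, the SAME pinned `χ`-factors and the SAME last
regions: only `TexpA` changes, `(𝐓e^A)'(a') := (𝐓e^A)(a') · Σ_{a : a″ = a'} ∫⌈_{fib a} t_a ∕ ∫⌈_{fib a} t_{a'}`.

WHAT THIS FILE IS.  §1 `rterm r a` (the term `t_a`), `rratio` (one normalisation ratio), **`rstepOfSel r sel fib : Step.Repr218 P G j`** (the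
R-stepped representation), its field lemmas, and the KERNEL IDENTITY **`holds_rstepOfSel : (rstepOfSel r sel fib).Holds (RopReal (rterm r) sel fib)`**
— the R-stepped representation represents (0.3) of the terms (`Finset.sum_fiberwise`, no analysis); §2 the same data as a b01∕n12-b
`RepData` (**`repDataOfSel`**: `Region := r.Adm`, `pp := sel`, `piece := rterm r`) with `repDataOfSel_total` and `repDataOfSel_rop` (`rfl`), so
that FILE 2 ∕ FILE 6 (`ropTotal` ∕ `ropTotalAE`, `AdmissibleAE`, `Provisos`) apply to it verbatim; §3 (0.4) AT REPRESENTATION LEVEL: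
**`integral_rop_rstepOfSel`** — under the provisos of p. 176 on the terms, `∫ RopReal (rterm r) sel fib dV = ∫ ρ dV` for every `ρ` the datum
represents (b01's PROVED `integral_ropReal_eq`), i.e. node00-def's `RepMachine.integral_step` for `Rstep k := fun r => rstepOfSel r (sel p k) (fib p k)`.

HONEST SCOPE.  One generic definition + finite-sum bookkeeping + b01's proved fibre lemma.  `sel` and `fib` are PARAMETERS here: on the
sequences of record `fib` is COMPUTED (FILE 5 `LargeFieldTowerOfRecord`: torus components + the class decision (i)∧(ii) → `Z′` → its bond
variables) and `sel` is the residual `PpSelOfRecord` pending dag-n12-a's word A7.  Nothing of Bałaban's asserted: not the provisos, not that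
the record's densities are represented (Theorem 1 [III]), no estimate.  Counts unmoved (typed 28∕28 · discharged 1∕28); nothing continuum ∕
ℝ⁴ ∕ OS ∕ mass-gap ∕ Clay.  No `sorry` ∕ `axiom` ∕ `opaque` ∕ `instance` ∕ `notation`.
-/

noncomputable section

open MeasureTheory
open scoped BigOperators

namespace Literature.MathematicalPhysics.QuantumFieldTheory.Balaban1983to89.Node00

open T4Continuum B15RopTotal
open B15.BasicStep (fibreIntegral normTerm RopReal)

section RStep

variable {P : Params} {G : Type*} [GaugeGroup G] [MeasurableSpace G] [HaarData G] {j : ℕ}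
variable [DecidableEq (PBond P j)]

/-! ## §1  The R-step on a (2.18) representation -/

/-- The TERM of an admissible sequence: `t_a := χ_k(a) · (𝐓_k e^{A_k})(a)` — one summand of (2.18). [cite: Balaban1988Convergent, (2.18) p.257] -/
def rterm (r : Step.Repr218 P G j) (a : r.Adm) : Density P j G := fun V => r.χ a V * r.TexpA a V

omit [MeasurableSpace G] [HaarData G] [DecidableEq (PBond P j)] in
/-- (2.18) says `ρ = Σ_a t_a`. [cite: Balaban1988Convergent, (2.18) p.257 (bookkeeping)] -/
theorem holds_iff_eq_sum_rterm (r : Step.Repr218 P G j) (ρ : Density P j G) :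
    r.Holds ρ ↔ ρ = fun V => ∑ a, rterm r a V :=
  ⟨fun h => funext h, fun h V => by rw [h]; rfl⟩

/-- ONE NORMALISATION RATIO of (0.3) for the sequence `a` against the term `a'`: `∫dV⌈_{Z′_a} t_a ∕ ∫dV⌈_{Z′_a} t_{a'}` (real division, b01's
`fibreIntegral`; the proviso «denominators positive» is a hypothesis of the theorems, not built in). [cite: Balaban1989LargeFieldI, (0.3) p.176] -/
def rratio (r : Step.Repr218 P G j) (fib : r.Adm → Finset (PBond P j)) (a a' : r.Adm) : GaugeField P j G → ℝ :=
  fun V => fibreIntegral (fib a) (rterm r a) V / fibreIntegral (fib a) (rterm r a') V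

open Classical in
/-- **THE R-STEP ON A (2.18) REPRESENTATION** given the selector data (`sel : a ↦ a″`, `fib a` = the `Z′`-variables): same sequences, same
pinned `χ`-factors, same last regions; `(𝐓e^A)'(a') := (𝐓e^A)(a') · Σ_{a : a″ = a'} ∫⌈_{fib a} t_a ∕ ∫⌈_{fib a} t_{a'}` — (0.3) re-indexed by
`a' = a″`. [cite: Balaban1989LargeFieldI, (0.3) p.176] -/
def rstepOfSel (r : Step.Repr218 P G j) (sel : r.Adm → r.Adm) (fib : r.Adm → Finset (PBond P j)) : Step.Repr218 P G j where
  Adm := r.Adm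
  finAdm := r.finAdm
  Zs := r.Zs
  finZs := r.finZs
  decZs := r.decZs
  χ := r.χ
  TexpA := fun a' V => r.TexpA a' V * ∑ a ∈ Finset.univ.filter (fun a => sel a = a'), rratio r fib a a' V
  lastZ := r.lastZ

/-- The R-step keeps the index set. [cite: Balaban1989LargeFieldI, (0.3) p.176 (bookkeeping)] -/
theorem rstepOfSel_Adm (r : Step.Repr218 P G j) (sel : r.Adm → r.Adm) (fib : r.Adm → Finset (PBond P j)) :
    (rstepOfSel r sel fib).Adm = r.Adm := rfl

/-- The R-step keeps the pinned `χ`-factors. [cite: Balaban1989LargeFieldI, (0.3) p.176 (bookkeeping)] -/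
theorem rstepOfSel_chi (r : Step.Repr218 P G j) (sel : r.Adm → r.Adm) (fib : r.Adm → Finset (PBond P j)) :
    (rstepOfSel r sel fib).χ = r.χ := rfl

/-- The R-step keeps the last large-field regions. [cite: Balaban1989LargeFieldI, (0.3) p.176 (bookkeeping)] -/
theorem rstepOfSel_lastZ (r : Step.Repr218 P G j) (sel : r.Adm → r.Adm) (fib : r.Adm → Finset (PBond P j)) :
    (rstepOfSel r sel fib).lastZ = r.lastZ := rfl

open Classical in
/-- The new `𝐓e^A` slot. [cite: Balaban1989LargeFieldI, (0.3) p.176 (bookkeeping)] -/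
theorem rstepOfSel_TexpA (r : Step.Repr218 P G j) (sel : r.Adm → r.Adm) (fib : r.Adm → Finset (PBond P j)) (a' : r.Adm)
    (V : GaugeField P j G) :
    (rstepOfSel r sel fib).TexpA a' V = r.TexpA a' V * ∑ a ∈ Finset.univ.filter (fun a => sel a = a'), rratio r fib a a' V := rfl

open Classical in
/-- **KERNEL IDENTITY: the R-stepped representation REPRESENTS (0.3) of the terms** — `Σ_{a'} χ(a')·(𝐓e^A)'(a') = Σ_a t_{a″}·∫⌈ t_a ∕ ∫⌈ t_{a″}
= RopReal t sel fib` (re-index by `a' = a″`; `Finset.sum_fiberwise`). [cite: Balaban1989LargeFieldI, (0.3) p.176] -/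
theorem holds_rstepOfSel (r : Step.Repr218 P G j) (sel : r.Adm → r.Adm) (fib : r.Adm → Finset (PBond P j)) :
    (rstepOfSel r sel fib).Holds (RopReal (rterm r) sel fib) := by
  intro V
  change ∑ a, normTerm (fib a) (rterm r (sel a)) (rterm r a) V
      = ∑ a' : r.Adm, r.χ a' V * (r.TexpA a' V * ∑ a ∈ Finset.univ.filter (fun a => sel a = a'), rratio r fib a a' V)
  have hre : ∀ a' : r.Adm, r.χ a' V * (r.TexpA a' V * ∑ a ∈ Finset.univ.filter (fun a => sel a = a'), rratio r fib a a' V)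
      = ∑ a ∈ Finset.univ.filter (fun a => sel a = a'), rterm r a' V * rratio r fib a a' V := by
    intro a'
    rw [← mul_assoc, Finset.mul_sum]
    rfl
  simp_rw [hre]
  have hfib : ∀ x : r.Adm, (∑ a ∈ Finset.univ.filter (fun a => sel a = x), rterm r x V * rratio r fib a x V)
      = ∑ a ∈ Finset.univ.filter (fun a => sel a = x), rterm r (sel a) V * rratio r fib a (sel a) V := by
    intro x
    refine Finset.sum_congr rfl fun a ha => ?_
    rw [(Finset.mem_filter.1 ha).2]
  simp_rw [hfib]
  rw [Finset.sum_fiberwise Finset.univ sel (fun a => rterm r (sel a) V * rratio r fib a (sel a) V)]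
  rfl

/-! ## §2  The same data as a `RepData` (so FILE 2 ∕ FILE 6 apply verbatim) -/

/-- The selector data as b01∕n12-b representation DATA: regions := the sequences, `pp := sel`, `fib`, pieces := the terms.
[cite: Balaban1989LargeFieldI, (0.2) p.176] -/
def repDataOfSel (r : Step.Repr218 P G j) (sel : r.Adm → r.Adm) (fib : r.Adm → Finset (PBond P j)) : RepData P j G where
  Region := r.Adm
  fin := r.finAdm
  pp := sel
  fib := fib
  piece := rterm r

omit [MeasurableSpace G] [HaarData G] [DecidableEq (PBond P j)] in
/-- Its total is `Σ_a t_a` (= `ρ` under (2.18)). [cite: Balaban1989LargeFieldI, (0.2) p.176 (bookkeeping)] -/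
theorem repDataOfSel_total (r : Step.Repr218 P G j) (sel : r.Adm → r.Adm) (fib : r.Adm → Finset (PBond P j)) :
    (repDataOfSel r sel fib).total = fun V => ∑ a, rterm r a V := rfl

omit [MeasurableSpace G] [HaarData G] [DecidableEq (PBond P j)] in
/-- Under (2.18) the datum's total IS the represented density. [cite: Balaban1988Convergent, (2.18) p.257 (bookkeeping)] -/
theorem repDataOfSel_total_eq_of_holds (r : Step.Repr218 P G j) (sel : r.Adm → r.Adm) (fib : r.Adm → Finset (PBond P j))
    {ρ : Density P j G} (h : r.Holds ρ) : (repDataOfSel r sel fib).total = ρ :=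
  ((holds_iff_eq_sum_rterm r ρ).1 h).symm

/-- Its (0.3) is `RopReal (rterm r) sel fib`. [cite: Balaban1989LargeFieldI, (0.3) p.176 (bookkeeping)] -/
theorem repDataOfSel_rop (r : Step.Repr218 P G j) (sel : r.Adm → r.Adm)
    (fib : r.Adm → Finset (PBond P j)) : (repDataOfSel r sel fib).rop = RopReal (rterm r) sel fib := rfl

open Classical in
/-- Hence the R-stepped representation represents the datum's (0.3). [cite: Balaban1989LargeFieldI, (0.3) p.176 (bookkeeping)] -/
theorem holds_rstepOfSel_rop (r : Step.Repr218 P G j) (sel : r.Adm → r.Adm)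
    (fib : r.Adm → Finset (PBond P j)) : (rstepOfSel r sel fib).Holds (repDataOfSel r sel fib).rop :=
  holds_rstepOfSel r sel fib

/-! ## §3  (0.4) at representation level -/

/-- **(0.4) AT REPRESENTATION LEVEL**: under the provisos of p. 176 on the terms (measurable, non-negative, uniformly bounded; denominators nowhere
zero) `∫ (0.3) dV = ∫ ρ dV` for every density `ρ` the representation represents — b01's PROVED `integral_ropReal_eq`; this is node00-def's
`RepMachine.integral_step` for `Rstep := rstepOfSel`. [cite: Balaban1989LargeFieldI, (0.4) p.176] -/
theorem integral_rop_rstepOfSel (r : Step.Repr218 P G j) (sel : r.Adm → r.Adm)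
    (fib : r.Adm → Finset (PBond P j)) (hprov : (repDataOfSel r sel fib).Provisos) {ρ : Density P j G} (hρ : r.Holds ρ) :
    ∫ V, RopReal (rterm r) sel fib V ∂(fieldMeasure P j G) = ∫ V, ρ V ∂(fieldMeasure P j G) := by
  obtain ⟨hm, h0, ⟨C, hC⟩, hden⟩ := hprov
  rw [B15.BasicStep.integral_ropReal_eq (rterm r) sel fib hm h0 hC hden, (holds_iff_eq_sum_rterm r ρ).1 hρ]

/-- The same with FILE 6's vocabulary: under the provisos the datum is a.e.-admissible at every density it represents (even pointwise admissible).
[cite: Balaban1989LargeFieldI, (0.3) p.176 (bookkeeping)] -/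
theorem admissible_repDataOfSel_of_holds (r : Step.Repr218 P G j) (sel : r.Adm → r.Adm)
    (fib : r.Adm → Finset (PBond P j)) (hprov : (repDataOfSel r sel fib).Provisos) {ρ : Density P j G} (hρ : r.Holds ρ) :
    Admissible (fun _ : Density P j G => repDataOfSel r sel fib) ρ :=
  ⟨repDataOfSel_total_eq_of_holds r sel fib hρ, hprov⟩


open Classical in
/-- The kernel identity in `eval` form: `Σ_{a'} χ(a')·(𝐓e^A)'(a') (V) = (RopReal t sel fib)(V)`. [cite: Balaban1989LargeFieldI, (0.3) p.176 (bookkeeping)] -/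
theorem sum_rstepOfSel_eq (r : Step.Repr218 P G j) (sel : r.Adm → r.Adm) (fib : r.Adm → Finset (PBond P j))
    (V : GaugeField P j G) :
    ∑ a, (rstepOfSel r sel fib).χ a V * (rstepOfSel r sel fib).TexpA a V = RopReal (rterm r) sel fib V :=
  ((holds_rstepOfSel r sel fib) V).symm

open Classical in
/-- **(0.4) in `eval` form** (node00-def's `RepMachine.integral_step` verbatim once `t.repr218 (k+1) = rstepOfSel (tT.repr218 (k+1)) sel fib`):
under the provisos, `∫ Σ_{a'} χ(a')(𝐓e^A)'(a') dV = ∫ Σ_a χ(a)(𝐓e^A)(a) dV`. [cite: Balaban1989LargeFieldI, (0.4) p.176] -/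
theorem integral_sum_rstepOfSel (r : Step.Repr218 P G j) (sel : r.Adm → r.Adm) (fib : r.Adm → Finset (PBond P j))
    (hprov : (repDataOfSel r sel fib).Provisos) :
    ∫ V, ∑ a, (rstepOfSel r sel fib).χ a V * (rstepOfSel r sel fib).TexpA a V ∂(fieldMeasure P j G)
      = ∫ V, ∑ a, r.χ a V * r.TexpA a V ∂(fieldMeasure P j G) := by
  simp_rw [sum_rstepOfSel_eq]
  exact integral_rop_rstepOfSel r sel fib hprov (ρ := fun V => ∑ a, r.χ a V * r.TexpA a V) fun _ => rfl

end RStep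

end Literature.MathematicalPhysics.QuantumFieldTheory.Balaban1983to89.Node00

end
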